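import Summits.HodgeConjecture.CorCM.IrreducibleOddWeightsShadowIdealsKernels
import HarnessLib

/-!
# Shadow ideals, VIII: a type equidistributed along the orbits of the STABILISER of every point of the partner slot
# never interacts with the partner — `Hg(A₀ × A₁) = Hg(A₀) × Hg(A₁)` whatever `Φ₁`, for ANY partner field

COR-CM (cell `pub-hodgecm2`, binder seat `b16` gen 63, count-neutral claim SHADOW IDEALS, file S8 — abstract `G`-set level
and CM fields; theorems only, no definition, no named fact, no `sorry`).  NEW as stated, hence under `Summits/`.  HONEST
FRAMING: a sufficient condition for `dim MT(A₀ × A₁) − 1 = (dim MT(A₀) − 1) + (dim MT(A₁) − 1)` and for the absence of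
mixed exceptional Hodge classes on `A₀^a × A₁^b`; `HC_CM` is neither used nor asserted.

By file S7 (`IrreducibleOddWeightsShadowIdealsKernels`) the pair `{Φ_{i₀}, Φ_{i₁}}` is additive iff no `G`-invariant
kernels `k₀` on `E_{i₁} × E_{i₀}`, `k₁` on `E_{i₁} × E_{i₁}` have `k₀·u₀ = k₁·u₁ ≠ 0`.  An invariant kernel `k₀(x₁, ·)` is
constant on the orbits of the stabiliser `Stab_G(x₁)` in `E_{i₀}`; so if `u₀ = u_1(Φ_{i₀})` SUMS TO ZERO over every such
orbit, for every `x₁ ∈ E_{i₁}`, then `k₀·u₀ = 0` for EVERY invariant `k₀` and the pair is additive — whatever `Φ_{i₁}`: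

* §1 `IrrOdd.sum_mul_eq_zero_of_orbit_sums_eq_zero` (a weight constant on the orbits of `H` integrates to zero against a
  weight with vanishing `H`-orbit sums); **`IrrOdd.forall_map_slotExt_le_of_forall_stabilizer_orbit_sums_eq_zero`**,
  rank form **`IrrOdd.typeRank_sigmaType_add_card_eq_of_forall_stabilizer_orbit_sums_eq_zero`**.
* §2 CM fields (`G = Aut(ℂ)`; `Stab(x₁) = Aut(ℂ/x₁(K_{i₁}))`, whose orbits on `Hom(K_{i₀}, ℂ)` are the classes of
  embeddings conjugate over the subfield `x₁(K_{i₁}) ⊂ ℂ` — the factors of `K_{i₀} ⊗_ℚ K_{i₁}` seen from `x₁`):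
  **`cmFamilyRank_add_card_eq_pair_of_forall_stabilizer_orbit_sums_eq_zero`** — if `Φ_{i₀}` meets every
  `Aut(ℂ/x₁(K_{i₁}))`-orbit on `Hom(K_{i₀}, ℂ)` in exactly half of its points, for every embedding `x₁` of `K_{i₁}`, then
  `Hg(A₀ × A₁) = Hg(A₀) × Hg(A₁)` for EVERY type `Φ_{i₁}` of `K_{i₁}`; `K_{i₁}` need NOT be normal, NOR embedded in `K_{i₀}`
  (gen 62 O3 `cmFamilyRank_add_card_eq_pair_of_shadow_eq_zero` is the case `K_{i₁}` normal, `K_{i₁} ↪ K_{i₀}`, where these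
  orbits are the fibres of restriction; O1/O2 asked balance along the FINER orbits of a subgroup inside the closure of the
  type stabilisers).  Hodge side: `forall_hodgeClassesProductSpan_pair_of_forall_stabilizer_orbit_sums_eq_zero`.

## References

* [Gordon1999HodgeAVSurvey] B. B. Gordon, *A survey of the Hodge conjecture for abelian varieties*, §3 Theorem (proof),
  7.5–7.7, 9.4.3.
* [Serre1977] J.-P. Serre, *Linear Representations of Finite Groups*, GTM 42, §7 Ex. 7.2.
* [MoonenZarhin1999LowDim] B. Moonen, Yu. Zarhin, Math. Ann. 315 (1999), §3 (3.1).
* [Shimura1998] G. Shimura, *Abelian Varieties with Complex Multiplication and Modular Functions*, §8.1, §8.3.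
-/

set_option autoImplicit false

noncomputable section

open scoped BigOperators Classical

universe u v w

namespace Summit.HodgeConjecture.CorCM

namespace IrrOdd

open Literature.NumberTheory.ComplexMultiplication

variable {G : Type w} [Group G]

/-! ### §1 Orbit sums of the stabilisers kill every invariant kernel -/

section Abstract

variable {X : Type v} [MulAction G X] [Fintype X]

/-- **A weight constant on the orbits of `H` integrates to zero against a weight with vanishing `H`-orbit sums.**
[folklore] -/
theorem sum_mul_eq_zero_of_orbit_sums_eq_zero (H : Subgroup G) (c u : X → ℚ) (hc : ∀ (h : H) (x : X), c (h • x) = c x)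
    (hu : ∀ a : X, ∑ x ∈ Finset.univ.filter (fun x => ∃ h : G, h ∈ H ∧ h • a = x), u x = 0) :
    ∑ x, c x * u x = 0 := by
  classical
  rw [← Finset.sum_fiberwise_of_maps_to (s := Finset.univ) (t := Finset.univ.image fun x => MulAction.orbit H x)
    (g := fun x => MulAction.orbit H x) (fun x _ => Finset.mem_image_of_mem _ (Finset.mem_univ x))]
  refine Finset.sum_eq_zero fun s hs => ?_
  obtain ⟨a, -, rfl⟩ := Finset.mem_image.1 hs
  have hfib : (Finset.univ.filter fun x => MulAction.orbit H x = MulAction.orbit H a) =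
      Finset.univ.filter fun x => ∃ h : G, h ∈ H ∧ h • a = x := by
    ext x
    simp only [Finset.mem_filter, Finset.mem_univ, true_and, MulAction.orbit_eq_iff, MulAction.mem_orbit_iff]
    constructor
    · rintro ⟨h, rfl⟩
      exact ⟨h, h.2, rfl⟩
    · rintro ⟨h, hh, rfl⟩
      exact ⟨⟨h, hh⟩, rfl⟩
  rw [hfib]
  have hconst : ∀ x ∈ Finset.univ.filter (fun x => ∃ h : G, h ∈ H ∧ h • a = x), c x * u x = c a * u x := by
    intro x hx
    obtain ⟨h, hh, rfl⟩ := (Finset.mem_filter.1 hx).2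
    rw [show h • a = (⟨h, hh⟩ : H) • a from rfl, hc]
  rw [Finset.sum_congr rfl hconst, ← Finset.mul_sum, hu a, mul_zero]

variable {I : Type u} {E : I → Type v} [∀ i, MulAction G (E i)] [DecidableEq I] [Fintype I] [∀ i, Fintype (E i)]

/-- **A TYPE BALANCED ON EVERY STABILISER ORBIT DOES NOT INTERACT WITH THE PARTNER SLOT.**  Two-slot family `{i₀, i₁}`;
if `u_1(Φ_{i₀})` sums to zero over every orbit of `Stab_G(x₁)` on `E_{i₀}`, for every `x₁ ∈ E_{i₁}`, then
`ext_i U(Φ_i) ≤ U(Σ)` for both slots (`Hg(A₀ × A₁) = Hg(A₀) × Hg(A₁)`), WHATEVER `Φ_{i₁}`.  (Every invariant kernel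
`k₀(x₁, ·)` is constant on those orbits, so `k₀·u₀ = 0`: no collision.) [cite: Gordon1999HodgeAVSurvey, §3 Theorem (proof)]
[cite: Serre1977, §7 Ex. 7.2] -/
theorem forall_map_slotExt_le_of_forall_stabilizer_orbit_sums_eq_zero {Φ : ∀ i, Set (E i)} {i₀ i₁ : I}
    (hI : ∀ j, j = i₀ ∨ j = i₁) (h01 : i₀ ≠ i₁)
    (hbal : ∀ (x₁ : E i₁) (a : E i₀),
      ∑ x ∈ Finset.univ.filter (fun x : E i₀ => ∃ g : G, g • x₁ = x₁ ∧ g • a = x), antiVec (Φ i₀) (1 : G) x = 0) :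
    ∀ i, (antiSpan G (Φ i)).map (slotExt i) ≤ antiSpan G (sigmaType Φ) := by
  classical
  refine forall_map_slotExt_le_of_not_exists_collision hI h01 ?_
  rintro ⟨α, β, hα, -, -, hne⟩
  apply hne
  funext x₁
  rw [Pi.zero_apply, apply_eq_sum_kernel α]
  refine sum_mul_eq_zero_of_orbit_sums_eq_zero (MulAction.stabilizer G x₁) _ _ (fun h x₀ => ?_) (fun a => ?_)
  · have h1 := kernel_invariant_of_equivariant α hα (h : G) x₁ x₀
    rwa [show (h : G) • x₁ = x₁ from MulAction.mem_stabilizer_iff.1 h.2] at h1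
  · have hfil : (Finset.univ.filter fun x : E i₀ => ∃ g : G, g ∈ MulAction.stabilizer G x₁ ∧ g • a = x) =
        Finset.univ.filter fun x : E i₀ => ∃ g : G, g • x₁ = x₁ ∧ g • a = x := by
      simp only [MulAction.mem_stabilizer_iff]
    rw [hfil]
    exact hbal x₁ a

variable [Nonempty I] [∀ i, Nonempty (E i)]

/-- **Rank form**: balance of `Φ_{i₀}` on every stabiliser orbit ⟹ `rank(Φ₀, Φ₁) + 2 = rank Φ₀ + rank Φ₁ + 1` for every
`Φ_{i₁}`. [cite: Gordon1999HodgeAVSurvey, §3 Theorem (1) and 7.7] -/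
theorem typeRank_sigmaType_add_card_eq_of_forall_stabilizer_orbit_sums_eq_zero {ρ : G} {Φ : ∀ i, Set (E i)}
    (h : ∀ i, IsCMTypeWith ρ (Φ i)) {i₀ i₁ : I} (hI : ∀ j, j = i₀ ∨ j = i₁) (h01 : i₀ ≠ i₁)
    (hbal : ∀ (x₁ : E i₁) (a : E i₀),
      ∑ x ∈ Finset.univ.filter (fun x : E i₀ => ∃ g : G, g • x₁ = x₁ ∧ g • a = x), antiVec (Φ i₀) (1 : G) x = 0) :
    typeRank G (sigmaType Φ) + Fintype.card I = (∑ i, typeRank G (Φ i)) + 1 :=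
  typeRank_sigmaType_add_card_eq_of_forall_map_le h
    (forall_map_slotExt_le_of_forall_stabilizer_orbit_sums_eq_zero hI h01 hbal)

/-- **Nondegeneracy form**: under the same balance, `Σ` is nondegenerate iff both members are.
[cite: Gordon1999HodgeAVSurvey, §3 Theorem (2) and 7.5–7.6.1] -/
theorem typeRank_sigmaType_eq_iff_forall_of_forall_stabilizer_orbit_sums_eq_zero {ρ : G} {Φ : ∀ i, Set (E i)}
    (h : ∀ i, IsCMTypeWith ρ (Φ i)) {i₀ i₁ : I} (hI : ∀ j, j = i₀ ∨ j = i₁) (h01 : i₀ ≠ i₁)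
    (hbal : ∀ (x₁ : E i₁) (a : E i₀),
      ∑ x ∈ Finset.univ.filter (fun x : E i₀ => ∃ g : G, g • x₁ = x₁ ∧ g • a = x), antiVec (Φ i₀) (1 : G) x = 0) :
    typeRank G (sigmaType Φ) = Fintype.card (Σ i, E i) / 2 + 1 ↔
      ∀ i, typeRank G (Φ i) = Fintype.card (E i) / 2 + 1 :=
  typeRank_sigmaType_eq_iff_forall_of_forall_map_le h
    (forall_map_slotExt_le_of_forall_stabilizer_orbit_sums_eq_zero hI h01 hbal)

end Abstract

end IrrOdd

/-! ### §2 CM fields: equidistribution over the conjugates of an arbitrary partner field -/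

section CM

open CategoryTheory CategoryTheory.Limits NumberField Module IntermediateField
open Literature.NumberTheory.ComplexMultiplication
open Literature.AlgebraicGeometry.Motives (AbelianVariety CMType)
open Literature.AlgebraicGeometry.Motives.AbelianVariety
open Literature.AlgebraicGeometry.HodgeTheory
open Literature.AlgebraicGeometry.ComplexMultiplication (IsCMTypeRealisation)
open Literature.AlgebraicGeometry.Pohlmann1968

variable {I : Type} [Fintype I] {K : I → Type} [∀ i, Field (K i)] [∀ i, NumberField (K i)] [∀ i, IsCMField (K i)]

omit [Fintype I] [∀ i, NumberField (K i)] [∀ i, IsCMField (K i)] in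
/-- The stabiliser of an embedding `x₁ : K_{i₁} → ℂ` in `Aut(ℂ)` is `Aut(ℂ/x₁(K_{i₁}))`: `g • x₁ = x₁ ⟺ g` fixes
`x₁(K_{i₁})` pointwise. [cite: Shimura1998, §8.1] -/
theorem smul_eq_self_iff_forall_apply_eq {i₁ : I} (g : ℂ ≃+* ℂ) (x₁ : K i₁ →+* ℂ) :
    g • x₁ = x₁ ↔ ∀ y : K i₁, g (x₁ y) = x₁ y :=
  ⟨fun h y => by rw [← ringEquiv_smul_apply g x₁ y, h], fun h => RingHom.ext fun y => by rw [ringEquiv_smul_apply, h]⟩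

/-- **A TYPE EQUIDISTRIBUTED OVER EVERY CONJUGATE OF THE PARTNER FIELD NEVER INTERACTS WITH THE PARTNER.**  Two-slot
family `{i₀, i₁}`, ARBITRARY CM fields (`K_{i₁}` neither normal nor embedded in `K_{i₀}`).  If for every embedding
`x₁ : K_{i₁} → ℂ` the type `Φ_{i₀}` meets every `Aut(ℂ/x₁(K_{i₁}))`-orbit on `Hom(K_{i₀}, ℂ)` (the embeddings of `K_{i₀}`
conjugate over the subfield `x₁(K_{i₁}) ⊂ ℂ`) in exactly half of its points — `Σ_{orbit} u_1(Φ_{i₀}) = 0` — then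
`Hg(A₀ × A₁) = Hg(A₀) × Hg(A₁)` for EVERY type `Φ_{i₁}`: `cmFamilyRank Φ + 2 = cmTypeRank Φ₀ + cmTypeRank Φ₁ + 1`.
[cite: Gordon1999HodgeAVSurvey, §3 Theorem (proof), 7.7 and 9.4.3] [cite: Shimura1998, §8.1 and §8.3] -/
theorem cmFamilyRank_add_card_eq_pair_of_forall_stabilizer_orbit_sums_eq_zero {i₀ i₁ : I} (h01 : i₀ ≠ i₁)
    (hI : ∀ l, l = i₀ ∨ l = i₁) (Φ : ∀ i, CMType (K i))
    (hbal : ∀ (x₁ : K i₁ →+* ℂ) (a : K i₀ →+* ℂ),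
      ∑ t ∈ Finset.univ.filter (fun t : K i₀ →+* ℂ => ∃ g : ℂ ≃+* ℂ, g • x₁ = x₁ ∧ g • a = t),
        antiVec (Φ i₀).1 (1 : ℂ ≃+* ℂ) t = 0) :
    CMAlgebra.cmFamilyRank Φ + Fintype.card I = (∑ i, cmTypeRank (Φ i)) + 1 := by
  haveI : Nonempty I := ⟨i₀⟩
  haveI : ∀ i, Nonempty (K i →+* ℂ) := fun i => inferInstance
  exact IrrOdd.typeRank_sigmaType_add_card_eq_of_forall_stabilizer_orbit_sums_eq_zero (G := ℂ ≃+* ℂ)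
    (E := fun i => K i →+* ℂ) (Φ := fun i => (Φ i).1) (fun i => isCMTypeWith_conj (Φ i)) hI h01 hbal

variable {Φ : ∀ i, CMType (K i)} {A : I → AbelianVariety ℂ} {ιA : ∀ i, 𝓞 (K i) →+* End (A i)}
  {θ : ∀ i, K i →+* Module.End ℂ (complexBetti (A i).X 1)}

/-- **… and then every rational Hodge class on every `A₀^a × A₁^b` (disjoint slot maps) is a sum of exterior products**:
NO MIXED exceptional classes, whatever `Φ_{i₁}`. [cite: MoonenZarhin1999LowDim, §3 (3.1)] [cite: Gordon1999HodgeAVSurvey, 7.5–7.7] -/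
theorem forall_hodgeClassesProductSpan_pair_of_forall_stabilizer_orbit_sums_eq_zero {i₀ i₁ : I} (h01 : i₀ ≠ i₁)
    (hI : ∀ l, l = i₀ ∨ l = i₁)
    (hbal : ∀ (x₁ : K i₁ →+* ℂ) (a : K i₀ →+* ℂ),
      ∑ t ∈ Finset.univ.filter (fun t : K i₀ →+* ℂ => ∃ g : ℂ ≃+* ℂ, g • x₁ = x₁ ∧ g • a = t),
        antiVec (Φ i₀).1 (1 : ℂ ≃+* ℂ) t = 0)
    (hA : ∀ i, IsCMTypeRealisation (Φ i) (A i) (ιA i) (θ i)) (N₁ N₂ : ℕ) [NeZero N₁] [NeZero N₂] (π₁ : Fin N₁ → I)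
    (π₂ : Fin N₂ → I) (hdisj : ∀ l₁ l₂, π₁ l₁ ≠ π₂ l₂) :
    HodgeClassesProductSpan (⨁ fun l => A (π₁ l)) (⨁ fun l => A (π₂ l)) := by
  haveI : Nonempty I := ⟨i₀⟩
  exact (cmFamilyRank_add_card_eq_iff_forall_hodgeClassesProductSpan hA).1
    (cmFamilyRank_add_card_eq_pair_of_forall_stabilizer_orbit_sums_eq_zero h01 hI Φ hbal) N₁ N₂ π₁ π₂ hdisj

end CM

end Summit.HodgeConjecture.CorCM

end
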